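import Mathlib
import HarnessLib
import Literature.MathematicalPhysics.StatisticalMechanics.KosterlitzRecursionFlowRobust

/-!
# The Nelson–Kosterlitz universal jump from a family of Kosterlitz-type flows (robust form)

Topic `Literature/MathematicalPhysics/StatisticalMechanics`. Third file of the group
`KosterlitzThoulessStiffnessBound` (the stability inequality `StableBelow` and the universal jump
`UniversalJumpAt` as named hypotheses on a stiffness profile) · `KosterlitzRecursionFlow` (both as
theorems of the TRUNCATED recursion relations, Nelson 2002 eqs. (2.61a,b), via the exact first
integral; bridge `universalJumpAt_of_flowLimit` with the separatrix hypothesis `ε(T) → 0` and the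
square-root cusp bound) · `KosterlitzRecursionFlowRobust` (the stability inequality for flows of
Kosterlitz type WITH `O(y³)` corrections, `IsPerturbedFlowTrajectory`). Here: the universal jump
`ρ(T) → (2/π)·T_c` (`T → T_c⁻`) for a FAMILY of Kosterlitz-type trajectories `T ↦ (K_T⁻¹, y_T)` with
higher-order corrections (any remainder constants, no equation for `K⁻¹` beyond monotonicity, no first
integral), from three hypotheses that are exactly the content of Nelson 2002, Fig. 2.6 and eq. (2.70):

* (i) below `T_c` the trajectory flows into the fixed line, `y_T(ℓ) → 0`, and the measured reduced
  stiffness is its limit, `ρ(T)/T = lim_ℓ K_T(ℓ)` (eq. (2.70), the identification);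
* (ii) AT `T_c` the trajectory runs into the END POINT of the stable fixed line, `K_{T_c}⁻¹(ℓ) → π/2`
  ("the superfluid is bounded by an incoming separatrix terminating at `K⁻¹(ℓ) = 2/π`" — read
  `π/2` in the coordinate `K⁻¹`; the locus of initial conditions crosses it at `T_c`);
* (iii) at every fixed scale `ℓ` the running coupling `K_T⁻¹(ℓ)` is lower semicontinuous (e.g.
  continuous) in `T` from the left at `T_c` (continuous dependence of the renormalisation trajectory
  on the bare couplings, which vary continuously with `T`).

## What is PROVED

* `universalJumpAt_of_robustFlowFamily` (and `…_of_tendsto` with plain left-continuity):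
  (i)–(iii) ⇒ `KosterlitzThouless.UniversalJumpAt ρ T_c`. The proof is a squeeze —
  `2/π ≤ K_R(T) ≤ K_T(ℓ)` for every `ℓ` (robust stability
  `IsPerturbedFlowTrajectory.exists_tendsto_stiffness_of_tendsto_fug_zero` and monotonicity of
  `K⁻¹(ℓ)`), while `K_T⁻¹(ℓ) → K_{T_c}⁻¹(ℓ) ↑ π/2` — and uses neither the first integral nor the cusp
  bound: "independent of the way in which the locus of initial conditions crosses the incoming
  separatrix" (Nelson 2002, after eq. (2.71)).
* `eq_two_div_pi_mul_of_tendsto` — at `T_c` itself the limit stiffness IS the universal value,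
  `ρ(T_c) = (2/π)·T_c` (the terminal points of Fig. 2.8 lie on the universal line).
* `universalJumpAt_of_flowFamily_separatrix` — the truncated case BY NAME: for a family of
  `IsFlowTrajectory` on the ordered side whose `T_c` member lies on the incoming separatrix of the
  first integral, hypothesis (ii) is `IsFlowTrajectory.tendsto_stiffness_of_separatrix` and (i) is
  `IsFlowTrajectory.tendsto_fug_zero_iff_ordered`, so left-continuity (iii) alone gives the jump —
  a second route to `KosterlitzRecursionFlow.universalJumpAt_of_flowLimit`.

## Rigour status

Elementary real analysis on given families of trajectories; no existence or continuous-dependence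
theorem for the flow is proved or needed — (iii) is a hypothesis. What remains a
renormalisation-group HYPOTHESIS about a physical system is (i)–(iii) for ITS bare couplings: the
identification (2.70), the flow into the fixed line below `T_c`, and the crossing of the separatrix
at `T_c`.

## Not here

No derivation of (ii) from "`T_c` separates the temperatures whose trajectories flow into the fixed
line from those that do not" (that needs two-sided bounds `A₁y² ≤ dK⁻¹/dℓ ≤ A₂y²`, the robust basin
of attraction of the fixed line and an integrability argument — not carried out); no microscopic
model.

## References

* D. R. Nelson, J. M. Kosterlitz, Phys. Rev. Lett. 39 (1977) 1201. [NelsonKosterlitz1977]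
* D. R. Nelson, *Defects and Geometry in Condensed Matter Physics*, CUP 2002, §2.2.3,
  eqs. (2.61)–(2.62), (2.70)–(2.72), Figs. 2.6, 2.8. [Nelson2002Defects]
-/

noncomputable section

open Filter Topology Set Real

namespace Literature.MathematicalPhysics.StatisticalMechanics

namespace KosterlitzThouless

/-! ## §1 The end point of the fixed line -/

namespace IsPerturbedFlowTrajectory

variable {C : ℝ} {u y : ℝ → ℝ}

/-- On a trajectory whose inverse stiffness runs into the END POINT `u = π/2` of the stable part of
the fixed line (the incoming separatrix of Nelson 2002, Fig. 2.6, "terminating at `K⁻¹(ℓ) = 2/π`"),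
the running stiffness tends to the critical value: `K(ℓ) → 2/π`.
[cite: Nelson2002Defects, §2.2.3 eq. (2.71), Fig. 2.6] -/
theorem tendsto_stiffness_two_div_pi_of_tendsto (hsep : Tendsto u atTop (𝓝 (π / 2))) :
    Tendsto (fun l => (u l)⁻¹) atTop (𝓝 (2 / π)) := by
  rw [show (2 : ℝ) / π = (π / 2)⁻¹ by rw [inv_div]]
  exact hsep.inv₀ (by positivity)

end IsPerturbedFlowTrajectory

/-! ## §2 The universal jump from a family of Kosterlitz-type trajectories -/

/-- **The Nelson–Kosterlitz universal jump from a family of Kosterlitz-type flows — robust form.**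
Let `T ↦ (u_T, y_T)` be the renormalisation trajectories started from the bare couplings at
temperature `T` (any remainder constants `C_T`, no equation for `K⁻¹` beyond monotonicity), and let
`ρ` be a stiffness profile. Suppose that, for `T` in a left neighbourhood of `T_c > 0`,
(i) the trajectory flows into the fixed line, `y_T(ℓ) → 0`, and `ρ(T)/T` IS its limit stiffness
`lim_ℓ K_T(ℓ)` (Nelson 2002, eq. (2.70)); (ii) at `T_c` itself the trajectory runs into the end point
of the fixed line, `K_{T_c}⁻¹(ℓ) → π/2` (the locus of initial conditions crosses the incoming
separatrix at `T_c`, Fig. 2.6); and (iii) at every fixed scale `ℓ ≥ 0` the running inverse stiffness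
is lower semicontinuous in `T` from the left at `T_c` (for every `c < K_{T_c}⁻¹(ℓ)`, eventually
`c < K_T⁻¹(ℓ)` as `T → T_c⁻`; e.g. `T ↦ K_T⁻¹(ℓ)` continuous). Then `ρ(T) → (2/π)·T_c` as `T → T_c⁻`:
`KosterlitzThouless.UniversalJumpAt ρ T_c`. Proof: `2/π ≤ K_R(T) ≤ K_T(ℓ)` for every `ℓ` (robust
stability and monotonicity), and `K_T⁻¹(ℓ) → K_{T_c}⁻¹(ℓ) ↑ π/2`; no first integral, no cusp bound —
"independent of the way in which the locus of initial conditions crosses the incoming separatrix".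
[cite: Nelson2002Defects, §2.2.3 eqs. (2.70)–(2.72), Fig. 2.6] -/
theorem universalJumpAt_of_robustFlowFamily {ρ : ℝ → ℝ} {Tc : ℝ} (hTc : 0 < Tc)
    (C : ℝ → ℝ) (u y : ℝ → ℝ → ℝ)
    (hflow : ∀ᶠ T in 𝓝[<] Tc, IsPerturbedFlowTrajectory (C T) (u T) (y T) ∧
      Tendsto (y T) atTop (𝓝 0) ∧ Tendsto (fun l => (u T l)⁻¹) atTop (𝓝 (ρ T / T)))
    (hsep : Tendsto (u Tc) atTop (𝓝 (π / 2)))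
    (hlsc : ∀ ⦃l : ℝ⦄, 0 ≤ l → ∀ ⦃c : ℝ⦄, c < u Tc l → ∀ᶠ T in 𝓝[<] Tc, c < u T l) :
    UniversalJumpAt ρ Tc := by
  have hπ : 0 < π := Real.pi_pos
  -- Step 1: `ρ(T)/T → 2/π` as `T → T_c⁻`
  have hquot : Tendsto (fun T => ρ T / T) (𝓝[<] Tc) (𝓝 (2 / π)) := by
    rw [tendsto_order]
    constructor
    · -- lower bound: `2/π ≤ ρ(T)/T` eventually (robust stability)
      intro a ha
      filter_upwards [hflow, Ioo_mem_nhdsLT hTc] with T hT hTI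
      obtain ⟨htraj, hy, hlim⟩ := hT
      have h2 := two_div_pi_mul_le_of_robustFlowLimit hTI.1 htraj hy hlim
      have h3 : 2 / π ≤ ρ T / T := by
        rw [le_div_iff₀ hTI.1]
        exact h2
      exact lt_of_lt_of_le ha h3
    · -- upper bound: for `b > 2/π`, eventually `ρ(T)/T < b`
      intro b hb
      have hb0 : 0 < b := lt_trans (by positivity) hb
      have hbinv : b⁻¹ < π / 2 := by
        rw [show π / 2 = (2 / π)⁻¹ by rw [inv_div]]
        exact (inv_lt_inv₀ hb0 (by positivity)).2 hb
      -- a scale `ℓ*` at which the critical trajectory is already past `b⁻¹`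
      obtain ⟨L, hL⟩ := eventually_atTop.1 ((tendsto_order.1 hsep).1 b⁻¹ hbinv)
      have hLs : b⁻¹ < u Tc (max L 0) := hL (max L 0) (le_max_left L 0)
      filter_upwards [hflow, hlsc (le_max_right L 0) hLs, Ioo_mem_nhdsLT hTc] with T hT hTl hTI
      obtain ⟨htraj, hy, hlim⟩ := hT
      obtain ⟨uinf, h0le, -, hulim⟩ := htraj.exists_tendsto_of_tendsto_fug_zero hy
      have hpos : 0 < uinf := htraj.inv_pos.trans_le h0le
      have hle : u T (max L 0) ≤ uinf := htraj.inv_le_of_tendsto hulim (le_max_right L 0)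
      have hKR : ρ T / T = uinf⁻¹ := tendsto_nhds_unique hlim (hulim.inv₀ hpos.ne')
      rw [hKR]
      have h1 : b⁻¹ < uinf := hTl.trans_le hle
      calc uinf⁻¹ < (b⁻¹)⁻¹ := (inv_lt_inv₀ hpos (inv_pos.2 hb0)).2 h1
        _ = b := inv_inv b
  -- Step 2: `ρ(T) = T · (ρ(T)/T) → T_c · (2/π)`
  have hT : Tendsto (fun T : ℝ => T) (𝓝[<] Tc) (𝓝 Tc) :=
    (continuous_id.tendsto Tc).mono_left nhdsWithin_le_nhds
  have hprod : Tendsto (fun T => T * (ρ T / T)) (𝓝[<] Tc) (𝓝 (Tc * (2 / π))) := hT.mul hquot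
  have hev : (fun T => T * (ρ T / T)) =ᶠ[𝓝[<] Tc] ρ := by
    filter_upwards [Ioo_mem_nhdsLT hTc] with T hT
    field_simp [hT.1.ne']
  unfold UniversalJumpAt
  rw [show 2 / π * Tc = Tc * (2 / π) by ring]
  exact hprod.congr' hev

/-- The same with plain left-CONTINUITY in `T` of the finite-scale couplings (the usual continuous
dependence of the renormalisation trajectory on its initial data) in place of lower semicontinuity.
[cite: Nelson2002Defects, §2.2.3 eqs. (2.70)–(2.72), Fig. 2.6] -/
theorem universalJumpAt_of_robustFlowFamily_of_tendsto {ρ : ℝ → ℝ} {Tc : ℝ} (hTc : 0 < Tc)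
    (C : ℝ → ℝ) (u y : ℝ → ℝ → ℝ)
    (hflow : ∀ᶠ T in 𝓝[<] Tc, IsPerturbedFlowTrajectory (C T) (u T) (y T) ∧
      Tendsto (y T) atTop (𝓝 0) ∧ Tendsto (fun l => (u T l)⁻¹) atTop (𝓝 (ρ T / T)))
    (hsep : Tendsto (u Tc) atTop (𝓝 (π / 2)))
    (hcont : ∀ ⦃l : ℝ⦄, 0 ≤ l → Tendsto (fun T => u T l) (𝓝[<] Tc) (𝓝 (u Tc l))) :
    UniversalJumpAt ρ Tc :=
  universalJumpAt_of_robustFlowFamily hTc C u y hflow hsep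
    fun _ hl _ hc => (tendsto_order.1 (hcont hl)).1 _ hc

/-- **At `T_c` the renormalised stiffness IS the universal value.** If the `T_c` trajectory is itself
a Kosterlitz-type trajectory running into the end point of the fixed line and `ρ(T_c)/T_c` is its limit
stiffness, then `ρ(T_c) = (2/π)·T_c` (the terminal points of Nelson 2002, Fig. 2.8 lie ON the universal
line). [cite: Nelson2002Defects, §2.2.3 eqs. (2.71)–(2.72), Fig. 2.8] -/
theorem eq_two_div_pi_mul_of_tendsto {ρTc Tc : ℝ} {u : ℝ → ℝ} (hTc : 0 < Tc)
    (hsep : Tendsto u atTop (𝓝 (π / 2)))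
    (hlim : Tendsto (fun l => (u l)⁻¹) atTop (𝓝 (ρTc / Tc))) : ρTc = 2 / π * Tc := by
  have hπ : 0 < π := Real.pi_pos
  have h1 : ρTc / Tc = 2 / π :=
    tendsto_nhds_unique hlim (IsPerturbedFlowTrajectory.tendsto_stiffness_two_div_pi_of_tendsto hsep)
  field_simp at h1
  rw [div_mul_eq_mul_div, eq_div_iff hπ.ne']
  linarith [h1]

/-- **The truncated case by name.** For a family of trajectories of the TRUNCATED recursion relations
(`IsFlowTrajectory`) on the ordered side whose `T_c` member lies ON the incoming separatrix
(`A·y(0)² = g(K⁻¹(0)) - g(π/2)`), hypothesis (ii) of `universalJumpAt_of_robustFlowFamily` is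
`IsFlowTrajectory.tendsto_stiffness_of_separatrix` of `KosterlitzRecursionFlow`, and the universal jump
follows from left-continuity of the finite-scale couplings alone — a second route to
`universalJumpAt_of_flowLimit` there, without the square-root cusp bound.
[cite: Nelson2002Defects, §2.2.3 eqs. (2.70)–(2.72), Fig. 2.6] -/
theorem universalJumpAt_of_flowFamily_separatrix {ρ : ℝ → ℝ} {Tc : ℝ} (hTc : 0 < Tc)
    (A : ℝ → ℝ) (u y : ℝ → ℝ → ℝ)
    (hflow : ∀ᶠ T in 𝓝[<] Tc, IsFlowTrajectory (A T) (u T) (y T) ∧ u T 0 < π / 2 ∧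
      A T * y T 0 ^ 2 ≤ flowPotential (u T 0) - flowPotential (π / 2) ∧
      Tendsto (fun l => (u T l)⁻¹) atTop (𝓝 (ρ T / T)))
    (hcrit : IsFlowTrajectory (A Tc) (u Tc) (y Tc)) (hu0 : u Tc 0 < π / 2)
    (hsep : A Tc * y Tc 0 ^ 2 = flowPotential (u Tc 0) - flowPotential (π / 2))
    (hcont : ∀ ⦃l : ℝ⦄, 0 ≤ l → Tendsto (fun T => u T l) (𝓝[<] Tc) (𝓝 (u Tc l))) :
    UniversalJumpAt ρ Tc := by
  -- the `T_c` trajectory runs into `u = π/2`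
  have hK := hcrit.tendsto_stiffness_of_separatrix hu0 hsep
  obtain ⟨uinf, h0le, -, hulim, -, -⟩ := hcrit.exists_tendsto_of_ordered hu0 hsep.le
  have hpos : 0 < uinf := hcrit.inv_pos.trans_le h0le
  have hinv : Tendsto (fun l => (u Tc l)⁻¹) atTop (𝓝 uinf⁻¹) := hulim.inv₀ hpos.ne'
  have heq : uinf⁻¹ = 2 / π := tendsto_nhds_unique hinv hK
  have huinf : uinf = π / 2 := by
    have := congrArg (fun x : ℝ => x⁻¹) heq
    simpa [inv_inv, inv_div] using this
  refine universalJumpAt_of_robustFlowFamily_of_tendsto hTc (fun _ => 0) u y ?_ (huinf ▸ hulim) hcont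
  filter_upwards [hflow] with T hT
  obtain ⟨htraj, hu0T, hside, hlim⟩ := hT
  exact ⟨htraj.isPerturbedFlowTrajectory le_rfl, (htraj.tendsto_fug_zero_iff_ordered).2 ⟨hu0T, hside⟩,
    hlim⟩

end KosterlitzThouless

end Literature.MathematicalPhysics.StatisticalMechanics
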